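import Summits.Ventures.CertifiedQuantumChemistry.Rows.MPOAutomaton
import HarnessLib

/-!
# Ventures/CertifiedQuantumChemistry — Rows/HamiltonianTermList.lean: the term list of the exact QC-MPO PRESENTS `H_F` —
# for EVERY model, as a theorem (raw list, one finite index type, real coefficients, real letters), and for every
# canonicalised / merged list derived from it by per-term sign data (FORMAT-qcmps0 §3 `canonical_word`, merging)

HONEST FRAMING (verbatim): certified bounds for a stated model Hamiltonian in a stated basis; not a
claim about the real molecule beyond that model.

var-2 (gen 12), zero compute, PROVED glue only (0 sorry, no definition, no claim node; nothing here asserts a bound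
about any model). `Rows/MPOAutomaton.lean` discharged the operator hypothesis `hO` of `Rows/MPSUpperBound.lean` to
per-edge facts about the MPO tensors PLUS one global hypothesis `hH : toSpin H_F = Σ_t c_t • ⨂_i w^t_i` — a term-list
presentation of `H_F` indexed by ONE finite type with REAL coefficients and REAL `4 × 4` letters; its NOT-CLAIMED list
left "(a) that the builder's term list presents `H_F`" as instance data. This file proves (a) generically:

* §Slot — `⨂` is multilinear in the letters: scaling letters scales the product operator by the product of the
  scalars (`productOp_smul_letters`, real form `productOp_map_ofReal_smul_letters`) — the `canonical_word` sign move.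
* §Canon — **re-presentation** (`sum_smul_productOp_eq_of_canon`, `toSpin_eq_sum_of_canon`): if every term `t` of a
  list is sent to a term `g t` of a second list with `⨂ w^t = ε_t • ⨂ w'^{g t}` (sign moves `ε_t = ±1`; identically
  zero words `ε_t = 0`) and the second list's coefficients are the fibre sums `c'_{t'} = Σ_{g t = t'} ε_t c_t`
  (merging equal words), then both lists present the same operator. Fibrewise bookkeeping, any `k`.
* §RealLetters — the tree's Jordan–Wigner letters `P`, `c_σ`, `c†_σ` (`Literature/…/HubbardJordanWigner`) have real
  (integer) entries, so they are the complexifications of their real parts; hence the one-body / two-body site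
  letters of `Rows/JordanWignerWords.lean` are complexified REAL letter products (`oneBodyLetter_map_ofReal`,
  `twoBodyLetter_map_ofReal`).
* §RawList — **`toSpin_hamiltonian_eq_sum_rawTerms`**: for EVERY `F : Model k`,
  `toSpin H_F = Σ_t (c_t : ℝ) • ⨂_z (w^t_z : ℝ^{4×4})` over the SINGLE finite index type
  `(p,q,σ) ⊕ (p,q,r,s,σ,τ) ⊕ unit` (one-body terms `h_pq`, two-body terms `(pq|rs)/2`, the constant `E_core` as the
  empty word), the letters being the entrywise real parts `X.map Complex.re` of the tree's integer letters —
  `Rows/JordanWignerWords`' nested complex sum re-indexed and made real: EXACTLY the shape of `hH`. The index type,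
  coefficients and words are written out as closed terms of the tree's vocabulary (no definition is introduced).
* §EndForm — **`upperRow_of_mps_trie_canon_sweeps`** = `upperRow_of_mps_trie_charges_sweeps` whose term list is any
  canonicalisation / merge (`g`, `ε`, `hw`, `hc`) of a list presenting `H_F`; with
  `hH := toSpin_hamiltonian_eq_sum_rawTerms F` every remaining hypothesis is instance data (per-term signs, per-edge
  tensor facts, per-block charge labels, the two sweeps' enclosures).

What is NOT claimed: which canonical list / signs / merges a given builder run produced, and that its emitted tensors
are organised over that list, stay instance data with the readers (`tests/test_mpo.py`, lineages A1 / B2 / B3 / B′);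
the orbital order is `Rows/OrbitalRelabelling.lean`'s business; no floating-point statement; no row; nothing is
instantiated. References: FORMAT-qcmps0 §2–§3 (HOME `pub-qchem-var2/`); qcmps `hamiltonian.py`
(`terms_from_integrals`, `canonical_word`, `word_of_ops`); T. Helgaker, P. Jørgensen, J. Olsen, *Molecular
Electronic-Structure Theory* (2000) eq. (2.2.18); P. Jordan, E. Wigner, Z. Phys. 47 (1928) 631; S. Keller, M. Dolfi,
M. Troyer, M. Reiher, J. Chem. Phys. 143 (2015) 244118 §II and G. K.-L. Chan, A. Keselman, N. Nakatani, Z. Li,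
S. R. White, J. Chem. Phys. 145 (2016) 014102 §II (the quantum-chemistry Hamiltonian as a sum of operator strings /
MPO term lists).
-/

noncomputable section

namespace Summit.Ventures.CertifiedQuantumChemistry

open Matrix Finset
open Literature.MathematicalPhysics.QuantumLattice
open Literature.MathematicalPhysics.QuantumLattice.JordanWigner
open Literature.MathematicalPhysics.QuantumChemistry

/-! ## Multilinearity: scaling the letters -/

section Slot

variable {Λ : Type*} [Fintype Λ] {q : ℕ}

/-- **`⨂ (ε_i • u_i) = (∏ ε_i) • ⨂ u_i`** — the product operator is multilinear in its letters; in particular moving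
letter signs into the coefficient (`canonical_word`) does not change `c_t • ⨂ w^t`. [folklore] -/
theorem productOp_smul_letters (ε : Λ → ℂ) (u : Λ → Matrix (Fin q) (Fin q) ℂ) :
    productOp (fun i => ε i • u i) = (∏ i, ε i) • productOp u := by
  ext σ τ
  simp only [productOp_apply, Matrix.smul_apply, smul_eq_mul, Finset.prod_mul_distrib]

/-- Real form: complexified scaled real letters. [folklore] -/
theorem productOp_map_ofReal_smul_letters (ε : Λ → ℝ) (u : Λ → Matrix (Fin q) (Fin q) ℝ) :
    productOp (fun i => (ε i • u i).map ((↑) : ℝ → ℂ)) =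
      ((∏ i, ε i : ℝ) : ℂ) • productOp (fun i => (u i).map ((↑) : ℝ → ℂ)) := by
  have h : (fun i => (ε i • u i).map ((↑) : ℝ → ℂ)) = fun i => (ε i : ℂ) • (u i).map ((↑) : ℝ → ℂ) := by
    funext i
    ext a b
    simp only [Matrix.map_apply, Matrix.smul_apply, smul_eq_mul, Complex.ofReal_mul]
  rw [h, productOp_smul_letters, Complex.ofReal_prod]

/-- **Per-site sign data give the word-level sign fact** (the hypothesis `hw` below, term by term): if every letter
of the word `w` is `s_i` times the letter of `w'` (`s_i = ±1` from `P c = −c P`, or `0`), then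
`⨂ w = (∏ s_i) • ⨂ w'` for the complexified letters. [folklore] -/
theorem productOp_map_ofReal_eq_smul_of_letters (s : Λ → ℝ) (w w' : Λ → Matrix (Fin q) (Fin q) ℝ)
    (h : ∀ i, w i = s i • w' i) :
    productOp (fun i => (w i).map ((↑) : ℝ → ℂ)) =
      ((∏ i, s i : ℝ) : ℂ) • productOp (fun i => (w' i).map ((↑) : ℝ → ℂ)) := by
  rw [show (fun i => (w i).map ((↑) : ℝ → ℂ)) = fun i => (s i • w' i).map ((↑) : ℝ → ℂ) from
    funext fun i => by rw [h i]]
  exact productOp_map_ofReal_smul_letters s w'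

end Slot

/-! ## Re-presentation: sign moves, merging, dropping zero words -/

section Canon

variable {Λ : Type*} [Fintype Λ] {q : ℕ} {T T' : Type*} [Fintype T] [Fintype T'] [DecidableEq T']

/-- **Two term lists present the same operator** when every term `t` of the first is sent to a term `g t` of the
second with `⨂ w^t = ε_t • ⨂ w'^{g t}` (`ε_t = ±1`: letter signs moved; `ε_t = 0`: an identically zero word, sent
anywhere) and the second list's coefficients are the fibre sums `c'_{t'} = Σ_{t : g t = t'} ε_t c_t` (equal words
merged; an unused `t'` gets `0`). Fibrewise bookkeeping (`Finset.sum_fiberwise`). [folklore] -/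
theorem sum_smul_productOp_eq_of_canon (c : T → ℂ) (w : T → Λ → Matrix (Fin q) (Fin q) ℂ) (c' : T' → ℂ)
    (w' : T' → Λ → Matrix (Fin q) (Fin q) ℂ) (g : T → T') (ε : T → ℂ)
    (hw : ∀ t, productOp (w t) = ε t • productOp (w' (g t)))
    (hc : ∀ t', c' t' = ∑ t ∈ univ.filter (fun t => g t = t'), ε t * c t) :
    ∑ t, c t • productOp (w t) = ∑ t', c' t' • productOp (w' t') := by
  rw [← Finset.sum_fiberwise univ g fun t => c t • productOp (w t)]
  refine Finset.sum_congr rfl fun t' _ => ?_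
  rw [hc t', Finset.sum_smul]
  refine Finset.sum_congr rfl fun t ht => ?_
  rw [hw t, smul_smul, (mem_filter.mp ht).2, mul_comm]

/-- **Re-presentation in the shape of `hH`** (real coefficients, complexified real letters on the chain `Fin k`): a
presentation `toSpin H = Σ_t c_t • ⨂_i w^t_i` and sign / merge data (`g`, `ε`, `hw`, `hc`) towards a second list give
`toSpin H = Σ_{t'} c'_{t'} • ⨂_i w'^{t'}_i`. -/
theorem toSpin_eq_sum_of_canon {k : ℕ} (H : Matrix (Finset (Orb (Fin k))) (Finset (Orb (Fin k))) ℂ)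
    (c : T → ℝ) (w : T → Fin k → Matrix (Fin 4) (Fin 4) ℝ) (c' : T' → ℝ)
    (w' : T' → Fin k → Matrix (Fin 4) (Fin 4) ℝ) (g : T → T') (ε : T → ℝ)
    (hw : ∀ t, productOp (fun i => (w t i).map ((↑) : ℝ → ℂ)) =
      (ε t : ℂ) • productOp (fun i => (w' (g t) i).map ((↑) : ℝ → ℂ)))
    (hc : ∀ t', c' t' = ∑ t ∈ univ.filter (fun t => g t = t'), ε t * c t)
    (hH : toSpin H = ∑ t, (c t : ℂ) • productOp (fun i => (w t i).map ((↑) : ℝ → ℂ))) :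
    toSpin H = ∑ t', (c' t' : ℂ) • productOp (fun i => (w' t' i).map ((↑) : ℝ → ℂ)) := by
  rw [hH]
  refine sum_smul_productOp_eq_of_canon _ _ _ _ g (fun t => (ε t : ℂ)) hw fun t' => ?_
  rw [hc t']
  push_cast
  rfl

end Canon

/-! ## The Jordan–Wigner letters are real -/

section RealLetters

/-- A complex matrix with real entries is the complexification of its entrywise real part. [folklore] -/
theorem map_re_map_ofReal {m n : Type*} (M : Matrix m n ℂ) (h : ∀ i j, (M i j).im = 0) :
    (M.map Complex.re).map ((↑) : ℝ → ℂ) = M := by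
  ext i j
  simp only [Matrix.map_apply]
  exact Complex.ext (by simp) (by simp [h i j])

/-- The parity letter `P = diag(1,-1,-1,1)` has real entries. -/
theorem im_siteParity_apply (i j : Fin 4) : (siteParity i j).im = 0 := by
  rw [siteParity_eq]
  fin_cases i <;> fin_cases j <;> simp

/-- The annihilation letters `c_↑ = E₀₁ + E₂₃`, `c_↓ = E₀₂ − E₁₃` have real entries. -/
theorem im_siteAnnihilation_apply (σ : Fin 2) (i j : Fin 4) : (siteAnnihilation σ i j).im = 0 := by
  fin_cases σ
  · show (siteAnnihilation 0 i j).im = 0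
    rw [siteAnnihilation_zero_eq]
    fin_cases i <;> fin_cases j <;> simp
  · show (siteAnnihilation 1 i j).im = 0
    rw [siteAnnihilation_one_eq]
    fin_cases i <;> fin_cases j <;> simp

/-- The creation letters `c†_σ = (c_σ)ᴴ` have real entries. -/
theorem im_siteCreation_apply (σ : Fin 2) (i j : Fin 4) : (siteCreation σ i j).im = 0 := by
  rw [siteCreation, conjTranspose_apply, Complex.star_def, Complex.conj_im, im_siteAnnihilation_apply, neg_zero]

/-- The real part of `P` complexifies back to `P`. -/
theorem siteParity_re_map_ofReal : (siteParity.map Complex.re).map ((↑) : ℝ → ℂ) = siteParity :=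
  map_re_map_ofReal _ im_siteParity_apply

/-- The real part of `c_σ` complexifies back to `c_σ`. -/
theorem siteAnnihilation_re_map_ofReal (σ : Fin 2) : ((siteAnnihilation σ).map Complex.re).map ((↑) : ℝ → ℂ) = siteAnnihilation σ :=
  map_re_map_ofReal _ (im_siteAnnihilation_apply σ)

/-- The real part of `c†_σ` complexifies back to `c†_σ`. -/
theorem siteCreation_re_map_ofReal (σ : Fin 2) : ((siteCreation σ).map Complex.re).map ((↑) : ℝ → ℂ) = siteCreation σ :=
  map_re_map_ofReal _ (im_siteCreation_apply σ)

/-- Complexification is multiplicative on `4 × 4` real matrices. [folklore] -/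
theorem map_ofReal_mul (A B : Matrix (Fin 4) (Fin 4) ℝ) :
    (A * B).map ((↑) : ℝ → ℂ) = A.map ((↑) : ℝ → ℂ) * B.map ((↑) : ℝ → ℂ) := by
  ext i j
  simp only [Matrix.map_apply, Matrix.mul_apply, Complex.ofReal_sum, Complex.ofReal_mul]

/-- Complexification of the real identity letter. [folklore] -/
theorem map_ofReal_one : (1 : Matrix (Fin 4) (Fin 4) ℝ).map ((↑) : ℝ → ℂ) = 1 :=
  Matrix.map_one _ Complex.ofReal_zero Complex.ofReal_one

/-- Complexification commutes with the three-way case split of a site letter. [folklore] -/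
theorem map_ofReal_ite_ite {P₁ P₂ : Prop} [Decidable P₁] [Decidable P₂] (A B C : Matrix (Fin 4) (Fin 4) ℝ) :
    (if P₁ then A else if P₂ then B else C).map ((↑) : ℝ → ℂ) =
      if P₁ then A.map ((↑) : ℝ → ℂ) else if P₂ then B.map ((↑) : ℝ → ℂ) else C.map ((↑) : ℝ → ℂ) := by
  split_ifs <;> rfl

variable {Λ : Type*} [LinearOrder Λ]

/-- **The one-body site letter is a complexified real letter**: at site `z` the letter of `c†_{pσ} c_{qσ}`
(`Rows/JordanWignerWords.toSpin_creation_mul_annihilation_eq_productOp`) is the complexification of the product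
of the real parts `(Re P | Re c†_σ | 1)_z · (Re P | Re c_σ | 1)_z`. -/
theorem oneBodyLetter_map_ofReal (p q z : Λ) (σ : Fin 2) :
    ((if z < p then siteParity.map Complex.re else if z = p then (siteCreation σ).map Complex.re
        else (1 : Matrix (Fin 4) (Fin 4) ℝ)) *
      (if z < q then siteParity.map Complex.re else if z = q then (siteAnnihilation σ).map Complex.re
        else 1)).map ((↑) : ℝ → ℂ) =
      (if z < p then siteParity else if z = p then siteCreation σ else 1) *
        (if z < q then siteParity else if z = q then siteAnnihilation σ else 1) := by
  simp only [map_ofReal_mul, map_ofReal_ite_ite, siteParity_re_map_ofReal, siteAnnihilation_re_map_ofReal,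
    siteCreation_re_map_ofReal, map_ofReal_one]

/-- **The two-body site letter is a complexified real letter**: at site `z` the letter of
`c†_{pσ} c†_{rτ} c_{sτ} c_{qσ}` (`Rows/JordanWignerWords.toSpin_twoBodyWord_eq_productOp`) is the complexification of the
ordered product of the four real letters. -/
theorem twoBodyLetter_map_ofReal (p q r s z : Λ) (σ τ : Fin 2) :
    ((if z < p then siteParity.map Complex.re else if z = p then (siteCreation σ).map Complex.re
        else (1 : Matrix (Fin 4) (Fin 4) ℝ)) *
      (if z < r then siteParity.map Complex.re else if z = r then (siteCreation τ).map Complex.re else 1) *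
      (if z < s then siteParity.map Complex.re else if z = s then (siteAnnihilation τ).map Complex.re else 1) *
      (if z < q then siteParity.map Complex.re else if z = q then (siteAnnihilation σ).map Complex.re
        else 1)).map ((↑) : ℝ → ℂ) =
      (if z < p then siteParity else if z = p then siteCreation σ else 1) *
        (if z < r then siteParity else if z = r then siteCreation τ else 1) *
        (if z < s then siteParity else if z = s then siteAnnihilation τ else 1) *
        (if z < q then siteParity else if z = q then siteAnnihilation σ else 1) := by
  simp only [map_ofReal_mul, map_ofReal_ite_ite, siteParity_re_map_ofReal, siteAnnihilation_re_map_ofReal,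
    siteCreation_re_map_ofReal, map_ofReal_one]

end RealLetters

/-! ## The raw term list of a model presents `H_F` -/

section RawList

variable {k : ℕ}

/-- **THE RAW TERM LIST PRESENTS `H_F` (FORMAT-qcmps0 §3 `terms_from_integrals`, before canonicalisation and merging),
for EVERY model.** Read in the site-major occupation basis, the model Hamiltonian is the finite sum over ONE index
type `(p,q,σ) ⊕ (p,q,r,s,σ,τ) ⊕ unit` of a REAL coefficient (`h_pq`, `(pq|rs)/2`, `E_core`) times the product operator
of complexified REAL `4 × 4` letters (the real parts of the Jordan–Wigner letters of `c†_{pσ}c_{qσ}`, of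
`c†_{pσ}c†_{rτ}c_{sτ}c_{qσ}`, and the empty word) — `Rows/JordanWignerWords.toSpin_molecularHamiltonian_eq_sum_productOp`
re-indexed by one finite type and made real; literally the shape of the hypothesis `hH` of `Rows/MPOAutomaton.lean`
(coefficients `c t`, words `w t z` = the two `Sum.elim` terms below, applied to `t`). -/
theorem toSpin_hamiltonian_eq_sum_rawTerms (F : Model k) :
    toSpin F.hamiltonian =
      ∑ t : (Fin k × Fin k × Fin 2) ⊕ (Fin k × Fin k × Fin k × Fin k × Fin 2 × Fin 2) ⊕ Unit,
        ((Sum.elim (fun t : Fin k × Fin k × Fin 2 => ((F.h t.1 t.2.1 : ℚ) : ℝ))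
            (Sum.elim (fun t : Fin k × Fin k × Fin k × Fin k × Fin 2 × Fin 2 =>
              ((F.eri t.1 t.2.1 t.2.2.1 t.2.2.2.1 : ℚ) : ℝ) / 2) (fun _ => ((F.ecore : ℚ) : ℝ))) t : ℝ) : ℂ) •
        productOp (fun z : Fin k => ((Sum.elim
            (fun (t : Fin k × Fin k × Fin 2) (z : Fin k) =>
              (if z < t.1 then siteParity.map Complex.re else if z = t.1 then (siteCreation t.2.2).map Complex.re
                else (1 : Matrix (Fin 4) (Fin 4) ℝ)) *
              (if z < t.2.1 then siteParity.map Complex.re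
                else if z = t.2.1 then (siteAnnihilation t.2.2).map Complex.re else 1))
            (Sum.elim
              (fun (t : Fin k × Fin k × Fin k × Fin k × Fin 2 × Fin 2) (z : Fin k) =>
                (if z < t.1 then siteParity.map Complex.re
                  else if z = t.1 then (siteCreation t.2.2.2.2.1).map Complex.re else (1 : Matrix (Fin 4) (Fin 4) ℝ)) *
                (if z < t.2.2.1 then siteParity.map Complex.re
                  else if z = t.2.2.1 then (siteCreation t.2.2.2.2.2).map Complex.re else 1) *
                (if z < t.2.2.2.1 then siteParity.map Complex.re
                  else if z = t.2.2.2.1 then (siteAnnihilation t.2.2.2.2.2).map Complex.re else 1) *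
                (if z < t.2.1 then siteParity.map Complex.re
                  else if z = t.2.1 then (siteAnnihilation t.2.2.2.2.1).map Complex.re else 1))
              (fun (_ : Unit) (_ : Fin k) => (1 : Matrix (Fin 4) (Fin 4) ℝ)))) t z).map ((↑) : ℝ → ℂ)) := by
  unfold Model.hamiltonian
  rw [toSpin_molecularHamiltonian_eq_sum_productOp, Fintype.sum_sum_type, Fintype.sum_sum_type, add_assoc]
  simp only [Sum.elim_inl, Sum.elim_inr]
  congr 1
  · -- one-body terms
    rw [Fintype.sum_prod_type]
    refine Finset.sum_congr rfl fun p _ => ?_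
    rw [Fintype.sum_prod_type]
    refine Finset.sum_congr rfl fun q _ => ?_
    rw [Finset.smul_sum]
    refine Finset.sum_congr rfl fun σ _ => ?_
    rw [Complex.ofReal_ratCast]
    congr 1
    congr 1
    funext z
    exact (oneBodyLetter_map_ofReal p q z σ).symm
  congr 1
  · -- two-body terms
    rw [Finset.smul_sum, Fintype.sum_prod_type]
    refine Finset.sum_congr rfl fun p _ => ?_
    rw [Finset.smul_sum, Fintype.sum_prod_type]
    refine Finset.sum_congr rfl fun q _ => ?_
    rw [Finset.smul_sum, Fintype.sum_prod_type]
    refine Finset.sum_congr rfl fun r _ => ?_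
    rw [Finset.smul_sum, Fintype.sum_prod_type]
    refine Finset.sum_congr rfl fun s _ => ?_
    rw [smul_smul, Finset.smul_sum, Fintype.sum_prod_type]
    refine Finset.sum_congr rfl fun σ _ => ?_
    rw [Finset.smul_sum]
    refine Finset.sum_congr rfl fun τ _ => ?_
    have hc : (1 / 2 : ℂ) * ((F.eri p q r s : ℚ) : ℂ) = ((((F.eri p q r s : ℚ) : ℝ) / 2 : ℝ) : ℂ) := by
      push_cast
      ring
    rw [hc]
    congr 1
    congr 1
    funext z
    exact (twoBodyLetter_map_ofReal p q r s z σ τ).symm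
  · -- the constant term (empty word)
    rw [Fintype.sum_unique, Complex.ofReal_ratCast]
    congr 1
    congr 1
    funext z
    exact map_ofReal_one.symm

end RawList

/-! ## END FORMS: the MPS upper row with `hH` discharged -/

section EndForm

variable {k : ℕ} {m : Type*} [Fintype m] [DecidableEq m] {T T' : Type*} [Fintype T] [Fintype T']
  [DecidableEq T'] {n : Type*} [Fintype n] [DecidableEq n]

/-- **END FORM — the MPS upper row from the builder's data (FORMAT-qcmps0 §0–§4).** For a symmetric model `F`
(`k ≥ 1`) presented by a term list `(c, w)` — for EVERY `F`, `hH := toSpin_hamiltonian_eq_sum_rawTerms F` — let the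
MPO's term list `(c', wt)` carry sign / merge data towards it: a map `g` and reals `ε` with `⨂ w^t = ε_t • ⨂ wt^{g t}`
for every term (letters sign-canonicalised, the sign into the coefficient, `canonical_word`; identically zero words
`ε_t = 0`) and `c'_{t'} = Σ_{g t = t'} ε_t c_t` (equal words merged). Then a trie / co-trie MPO organised over `(c', wt)`
(`hends`, `hshared`, `hswitch`, `hdisj`, `hedges` of `Rows/MPOAutomaton.lean`), an MPS state file passing the §1.2
charge-label checks, the two exact sweeps with that MPO and their enclosures with the value rule prove
`UpperRow F a b hi`. With `hH` so instantiated nothing but instance data is left: per-term sign facts, per-edge tensor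
facts, per-block label facts and the enclosure arithmetic — the readers' data, as for every certificate class. -/
theorem upperRow_of_mps_trie_canon_sweeps (hk : 0 < k) {F : Model k} (hF : F.IsSymmetric) {a b : ℕ}
    (c : T → ℝ) (wr : T → Fin k → Matrix (Fin 4) (Fin 4) ℝ)
    (hH : toSpin F.hamiltonian = ∑ t, (c t : ℂ) • productOp (fun i : Fin k => (wr t i).map ((↑) : ℝ → ℂ)))
    (c' : T' → ℝ) (wt : T' → Fin k → Matrix (Fin 4) (Fin 4) ℝ) (g : T → T') (ε : T → ℝ)
    (hw : ∀ t, productOp (fun i : Fin k => (wr t i).map ((↑) : ℝ → ℂ)) =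
      (ε t : ℂ) • productOp (fun i => (wt (g t) i).map ((↑) : ℝ → ℂ)))
    (hc : ∀ t', c' t' = ∑ t ∈ univ.filter (fun t => g t = t'), ε t * c t)
    (W : ℕ → m → m → Matrix (Fin 4) (Fin 4) ℝ) (x₀ y₀ : m) (σ : T' → Fin (k + 1) → m) (sw : T' → Fin k)
    (hends : ∀ t, σ t 0 = x₀ ∧ σ t (Fin.last k) = y₀)
    (hshared : ∀ t (i : Fin k), i ≠ sw t → W i (σ t (Fin.castSucc i)) (σ t i.succ) = wt t i)
    (hswitch : ∀ t, W (sw t) (σ t (Fin.castSucc (sw t))) (σ t (sw t).succ) =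
      ∑ t' ∈ univ.filter (fun t' => σ t' = σ t), c' t' • wt t' (sw t))
    (hdisj : ∀ (b : Fin (k + 1)) (t t' : T'), σ t' b = σ t b → (b : ℕ) ≤ sw t → (b : ℕ) ≤ sw t')
    (hedges : ∀ (i : Fin k) (x y : m), W i x y ≠ 0 →
      ((∃ t, σ t i.succ = y ∧ (i : ℕ) + 1 ≤ sw t) ∧
          ∀ t, σ t i.succ = y → (i : ℕ) + 1 ≤ sw t → σ t (Fin.castSucc i) = x) ∨
        ((∃ t, σ t (Fin.castSucc i) = x ∧ (sw t : ℕ) < i) ∧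
          ∀ t, σ t (Fin.castSucc i) = x → (sw t : ℕ) < i → σ t i.succ = y) ∨
        (∃ t, sw t = i ∧ σ t (Fin.castSucc i) = x ∧ σ t i.succ = y))
    (A : ℕ → Fin 4 → Matrix n n ℝ) (u w : n → ℝ) (ch : Fin (k + 1) → n → ℕ × ℕ)
    (hA : ∀ (i : Fin k) (s : Fin 4) (x y : n), A i s x y ≠ 0 → ch i.succ y = ch (Fin.castSucc i) x +
      (if (0 : Fin 2) ∈ siteOcc s then 1 else 0, if (1 : Fin 2) ∈ siteOcc s then 1 else 0))
    (hu : ∀ x, u x ≠ 0 → ch 0 x = (0, 0)) (hwv : ∀ y, w y ≠ 0 → ch (Fin.last k) y = (a, b))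
    (L : ℕ → m → Matrix n n ℝ)
    (hL : ∀ j y, L (j + 1) y = ∑ x, ∑ s, ∑ s', W j x y s s' • ((A j s)ᵀ * L j x * A j s'))
    (hL0 : ∀ x, L 0 x = if x = x₀ then vecMulVec u u else 0)
    (G : ℕ → Matrix n n ℝ) (hG : ∀ j, G (j + 1) = ∑ s, (A j s)ᵀ * G j * A j s) (hG0 : G 0 = vecMulVec u u)
    {hhi nlo nhi : ℝ} (hh : w ⬝ᵥ (L k y₀ *ᵥ w) ≤ hhi) (hlo : nlo ≤ w ⬝ᵥ (G k *ᵥ w))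
    (hnhi : w ⬝ᵥ (G k *ᵥ w) ≤ nhi) (hpos : 0 < nlo) {hi : ℚ} (hE : max (hhi / nlo) (hhi / nhi) ≤ ((hi : ℚ) : ℝ)) :
    UpperRow F a b hi :=
  upperRow_of_mps_trie_charges_sweeps hk hF c' wt (toSpin_eq_sum_of_canon F.hamiltonian c wr c' wt g ε hw hc hH)
    W x₀ y₀ σ sw hends hshared hswitch hdisj hedges A u w ch hA hu hwv L hL hL0 G hG hG0 hh hlo hnhi hpos hE

end EndForm

end Summit.Ventures.CertifiedQuantumChemistry

end
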